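import Summits.AnomalousDissipation.AnomalousDissipation.Theorems.BaireTransferDenseLoudDesignerForcesHomoclinicLine
import Literature.Analysis.FunctionSpaces.TorusTrilinearH1

/-!
# Stub `stub_trainBudget` of the line `homoclinic-excursion-trains`
# (crux stmt-AnomalousDissipation-1143, `BaireTransfer.DenseLoudDesignerForces`)

The BUDGET step of the composition `loopSet_subset_loudSet_of` of the vocabulary module
`Theorems/BaireTransferDenseLoudDesignerForcesHomoclinicLine.lean`: a one-loop train `u` (period `ℓ + d`,
`δ`-close in `H¹` to the excursion `u_Γ` on one full period `[-d/2, ℓ + d/2]`) inherits the excursion's window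
dissipation floor weighted by the DUTY `ℓ/(ℓ+d)`, and its window-mean energy plus the fatness `P̄` weighted by
`d/(ℓ+d)`:

* `(εₓ − 2νδ√Ḡ) · ℓ/(ℓ+d) ≤ ⟨ν‖∇u‖²⟩`,
* `⟨‖u‖²⟩ ≤ 2Ē + 2δ² + 2P̄ · d/(ℓ+d)`.

Pure torus calculus: the period means are period integrals (`Negative.meanDissipation_eq_period_mean`,
`Negative.meanEnergy_eq_period_mean`), shifted to the window-centred period by periodicity; pointwise in time,
Minkowski for the gradient seminorm (`‖∇u_Γ‖ ≤ ‖∇u‖ + δ`, packaged through `Torus.sqrt_integral_norm_add_sq_le`)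
gives `‖∇u(t)‖₂² ≥ ‖∇u_Γ(t)‖₂² − 2δ√Ḡ` on the window, and the parallelogram bound gives
`‖u(t)‖₂² ≤ 2‖u_Γ(t)‖₂² + 2δ²` on the whole period; integrate and drop / bound the two dwell pieces.
-/

-- `Summit.<Summit>.<Problem>` is the tree's mandated summit-side namespace (CONVENTIONS §2); for this
-- single-conjunct summit the two coincide, so the duplicate is deliberate.
set_option linter.dupNamespace false

noncomputable section

open scoped BigOperators Topology
open Filter Set Function TopologicalSpace MeasureTheory

namespace Summit.AnomalousDissipation.AnomalousDissipation.Theorems.DenseLoudDesignerForces.Homoclinic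

open Literature.Analysis.FunctionSpaces Literature.Analysis.FunctionSpaces.Torus
open Literature.Analysis.FluidPDE
open Summit.AnomalousDissipation.AnomalousDissipation.Theses.BaireTransfer
open Summit.AnomalousDissipation.AnomalousDissipation.Theorems.DenseLoudDesignerForces.Negative

/-- The flat unit torus `T³`. -/
local notation "𝕋³" => UnitAddTorus (Fin 3)
/-- Real velocity values. -/
local notation "ℝ³" => EuclideanSpace ℝ (Fin 3)

/-! ## Pointwise-in-time helpers -/

/-- `∂ᵢ(w − v) = ∂ᵢw − ∂ᵢv` pointwise, for smooth fields (from `Torus.partialDeriv_add`). [folklore] -/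
theorem stub_trainBudget_aux_partialDeriv_sub {v w : 𝕋³ → ℝ³} (hv : IsSmooth v) (hw : IsSmooth w)
    (i : Fin 3) (x : 𝕋³) :
    partialDeriv i (fun y => w y - v y) x = partialDeriv i w x - partialDeriv i v x := by
  have h := congrFun
    (Torus.partialDeriv_add ((hw.sub hv).isContDiff (by simp)) (hv.isContDiff (by simp)) i) x
  rw [sub_add_cancel, Pi.add_apply] at h
  rw [eq_sub_iff_add_eq]
  exact h.symm

/-- `‖∇f‖₂²` is the Bochner `∫‖·‖²` of the packed gradient `x ↦ (∂ᵢf x)ᵢ ∈ (ℝ³)³` (nine first partial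
derivatives in one Euclidean vector). [folklore] -/
theorem stub_trainBudget_aux_gradNormSq_eq (f : 𝕋³ → ℝ³) :
    gradNormSq f =
      ∫ x, ‖(WithLp.toLp 2 (fun i => partialDeriv i f x) : PiLp 2 (fun _ : Fin 3 => ℝ³))‖ ^ 2 := by
  unfold gradNormSq
  congr 1
  funext x
  rw [PiLp.norm_sq_eq_of_L2]

/-- The packed gradient of a smooth field is continuous. [folklore] -/
theorem stub_trainBudget_aux_continuous_gradVec {f : 𝕋³ → ℝ³} (hf : IsSmooth f) :
    Continuous fun x => (WithLp.toLp 2 (fun i => partialDeriv i f x) : PiLp 2 (fun _ : Fin 3 => ℝ³)) :=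
  (PiLp.continuous_toLp 2 _).comp (continuous_pi fun i => (hf.partialDeriv i).continuous)

/-- **Minkowski for the gradient seminorm**: `‖∇v‖₂ ≤ ‖∇w‖₂ + ‖∇(w − v)‖₂` for smooth fields on `T³`
(`Torus.sqrt_integral_norm_add_sq_le` for the packed gradients, `∂ᵢv = ∂ᵢw − ∂ᵢ(w − v)`). [folklore] -/
theorem stub_trainBudget_aux_sqrt_gradNormSq_le {v w : 𝕋³ → ℝ³} (hv : IsSmooth v) (hw : IsSmooth w) :
    Real.sqrt (gradNormSq v) ≤
      Real.sqrt (gradNormSq w) + Real.sqrt (gradNormSq (fun x => w x - v x)) := by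
  have hsum : ∀ x, (WithLp.toLp 2 (fun i => partialDeriv i v x) : PiLp 2 (fun _ : Fin 3 => ℝ³)) =
      WithLp.toLp 2 (fun i => partialDeriv i w x) +
        -WithLp.toLp 2 (fun i => partialDeriv i (fun y => w y - v y) x) := by
    intro x
    rw [← WithLp.toLp_neg, ← WithLp.toLp_add]
    congr 1
    funext i
    rw [Pi.add_apply, Pi.neg_apply, stub_trainBudget_aux_partialDeriv_sub hv hw i x]
    abel
  have h := sqrt_integral_norm_add_sq_le (stub_trainBudget_aux_continuous_gradVec hw)
    (stub_trainBudget_aux_continuous_gradVec (f := fun y => w y - v y) (hw.sub hv)).fun_neg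
  simp only [norm_neg] at h
  have hfun : (fun x => ‖(WithLp.toLp 2 (fun i => partialDeriv i v x) : PiLp 2 (fun _ : Fin 3 => ℝ³))‖ ^ 2) =
      fun x => ‖(WithLp.toLp 2 (fun i => partialDeriv i w x) : PiLp 2 (fun _ : Fin 3 => ℝ³)) +
        -WithLp.toLp 2 (fun i => partialDeriv i (fun y => w y - v y) x)‖ ^ 2 :=
    funext fun x => by rw [hsum x]
  rw [stub_trainBudget_aux_gradNormSq_eq v, stub_trainBudget_aux_gradNormSq_eq w,
    stub_trainBudget_aux_gradNormSq_eq (fun x => w x - v x), hfun]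
  exact h

/-- Elementary: `0 ≤ s ≤ r + δ`, `r, δ ≥ 0`, `s ≤ S` ⇒ `s² − 2δS ≤ r²`. [folklore] -/
theorem stub_trainBudget_aux_sq_sub_le {s r δ S : ℝ} (hs : 0 ≤ s) (hr : 0 ≤ r) (hδ : 0 ≤ δ)
    (hsr : s ≤ r + δ) (hsS : s ≤ S) : s ^ 2 - 2 * δ * S ≤ r ^ 2 := by
  have h1 : s ^ 2 - 2 * δ * S ≤ s ^ 2 - 2 * δ * s := by nlinarith
  rcases le_or_gt 0 (s - δ + r) with h | h
  · nlinarith [mul_nonneg h (by linarith : 0 ≤ r + δ - s)]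
  · nlinarith [mul_nonneg hs (by linarith : 0 ≤ 2 * δ - s), sq_nonneg r]

/-- **Dissipation is lower semi-stable in `H¹`, pointwise in time**: if `‖∇(w − v)‖₂² ≤ δ²` and
`‖∇v‖₂² ≤ Ḡ` then `‖∇w‖₂² ≥ ‖∇v‖₂² − 2δ√Ḡ`. [folklore] -/
theorem stub_trainBudget_aux_gradNormSq_window {v w : 𝕋³ → ℝ³} (hv : IsSmooth v) (hw : IsSmooth w)
    {δ Gb : ℝ} (hδ : 0 ≤ δ) (hclose : gradNormSq (fun x => w x - v x) ≤ δ ^ 2)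
    (hG : gradNormSq v ≤ Gb) : gradNormSq v - 2 * δ * Real.sqrt Gb ≤ gradNormSq w := by
  have hmink := stub_trainBudget_aux_sqrt_gradNormSq_le hv hw
  have he : Real.sqrt (gradNormSq (fun x => w x - v x)) ≤ δ := by
    rw [← Real.sqrt_sq hδ]
    exact Real.sqrt_le_sqrt hclose
  have hS : Real.sqrt (gradNormSq v) ≤ Real.sqrt Gb := Real.sqrt_le_sqrt hG
  have key := stub_trainBudget_aux_sq_sub_le (s := Real.sqrt (gradNormSq v))
    (r := Real.sqrt (gradNormSq w)) (Real.sqrt_nonneg _) (Real.sqrt_nonneg _) hδ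
    (hmink.trans (add_le_add le_rfl he)) hS
  rwa [Real.sq_sqrt (gradNormSq_nonneg _), Real.sq_sqrt (gradNormSq_nonneg _)] at key

/-- **Energy is upper semi-stable in `L²`, pointwise in time**: `∫‖w‖² ≤ 2∫‖v‖² + 2δ²` whenever
`∫‖w − v‖² ≤ δ²` (parallelogram bound pointwise, integrated). [folklore] -/
theorem stub_trainBudget_aux_energy_window {v w : 𝕋³ → ℝ³} (hv : IsSmooth v) (hw : IsSmooth w)
    {δ : ℝ} (hclose : ∫ x, ‖w x - v x‖ ^ 2 ≤ δ ^ 2) :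
    ∫ x, ‖w x‖ ^ 2 ≤ 2 * (∫ x, ‖v x‖ ^ 2) + 2 * δ ^ 2 := by
  have hiv : Integrable (fun x => ‖v x‖ ^ 2) := hv.norm_sq.integrable
  have hiw : Integrable (fun x => ‖w x‖ ^ 2) := hw.norm_sq.integrable
  have hid : Integrable (fun x => ‖w x - v x‖ ^ 2) := (hw.sub hv).norm_sq.integrable
  have hpt : ∀ x, ‖w x‖ ^ 2 ≤ 2 * ‖v x‖ ^ 2 + 2 * ‖w x - v x‖ ^ 2 := fun x => by
    have h := norm_add_le (v x) (w x - v x)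
    rw [add_sub_cancel] at h
    nlinarith [norm_nonneg (v x), norm_nonneg (w x - v x), norm_nonneg (w x),
      sq_nonneg (‖v x‖ - ‖w x - v x‖)]
  calc ∫ x, ‖w x‖ ^ 2 ≤ ∫ x, (2 * ‖v x‖ ^ 2 + 2 * ‖w x - v x‖ ^ 2) :=
        integral_mono hiw ((hiv.const_mul 2).add (hid.const_mul 2)) hpt
    _ = 2 * (∫ x, ‖v x‖ ^ 2) + 2 * ∫ x, ‖w x - v x‖ ^ 2 := by
        rw [integral_add (hiv.const_mul 2) (hid.const_mul 2), integral_const_mul, integral_const_mul]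
    _ ≤ 2 * (∫ x, ‖v x‖ ^ 2) + 2 * δ ^ 2 := by linarith

/-! ## The stub -/

/-- **Train budget** (registered stub `stub_trainBudget` of the line `homoclinic-excursion-trains`): a one-loop
train `u` of the excursion `u_Γ` (cut `ℓ > 0`, accuracy `δ ≥ 0`, dwell `d ≥ 0`) with a loud excursion window
`ν∫₀^ℓ‖∇u_Γ‖² ≥ εₓℓ` of window-mean energy `≤ Ē`, fatness `P̄` and gradient bound `Ḡ` satisfies
`(εₓ − 2νδ√Ḡ)·ℓ/(ℓ+d) ≤ ⟨ν‖∇u‖²⟩` and `⟨‖u‖²⟩ ≤ 2Ē + 2δ² + 2P̄·d/(ℓ+d)` (duty-weighted two-sided period-mean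
bookkeeping). [folklore] -/
theorem stub_trainBudget {ν ℓ δ d εx Eb Pb Gb : ℝ} {F : 𝕋³ → ℝ³} {uΓ u : ℝ → 𝕋³ → ℝ³} {pΓ p : ℝ → 𝕋³ → ℝ}
    (hν : 0 ≤ ν) (hℓ : 0 < ℓ) (hd : 0 ≤ d) (hδ : 0 ≤ δ)
    (hΓ : IsClassicalNSSolutionOn Set.univ ν (fun _ => F) uΓ pΓ) (htrain : IsTrain ν F uΓ ℓ δ d u p)
    (hwin : εx * ℓ ≤ ν * ∫ t in (0 : ℝ)..ℓ, gradNormSq (uΓ t))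
    (hwinE : (∫ t in (0 : ℝ)..ℓ, (∫ x, ‖uΓ t x‖ ^ 2)) ≤ Eb * ℓ)
    (hP : ∀ t, (∫ x, ‖uΓ t x‖ ^ 2) ≤ Pb) (hG : ∀ t, gradNormSq (uΓ t) ≤ Gb) :
    (εx - 2 * ν * δ * Real.sqrt Gb) * (ℓ / (ℓ + d)) ≤ meanDissipation ν u ∧
      meanEnergy u ≤ 2 * Eb + 2 * δ ^ 2 + 2 * Pb * (d / (ℓ + d)) := by
  obtain ⟨hsol, hper, hclose⟩ := htrain
  have hu : IsSmoothSpaceTimeOn univ u := hsol.smooth_velocity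
  have hΓs : IsSmoothSpaceTimeOn univ uΓ := hΓ.smooth_velocity
  have hτ : 0 < ℓ + d := by linarith
  -- continuity in time of the four profiles
  have hGc : Continuous fun t => gradNormSq (u t) :=
    continuousOn_univ.1 (hu.continuousOn_gradNormSq convex_univ uniqueDiffOn_univ)
  have hGΓc : Continuous fun t => gradNormSq (uΓ t) :=
    continuousOn_univ.1 (hΓs.continuousOn_gradNormSq convex_univ uniqueDiffOn_univ)
  have hEc : Continuous fun t => ∫ x, ‖u t x‖ ^ 2 :=
    continuousOn_univ.1 (hu.normSq.continuousOn_integral convex_univ)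
  have hEΓc : Continuous fun t => ∫ x, ‖uΓ t x‖ ^ 2 :=
    continuousOn_univ.1 (hΓs.normSq.continuousOn_integral convex_univ)
  have hGi : ∀ a b, IntervalIntegrable (fun t => gradNormSq (u t)) volume a b := fun a b =>
    hGc.intervalIntegrable a b
  have hEi : ∀ a b, IntervalIntegrable (fun t => ∫ x, ‖u t x‖ ^ 2) volume a b := fun a b =>
    hEc.intervalIntegrable a b
  -- periodic shift of the period integrals to the window-centred period `[-d/2, ℓ + d/2]`
  have hperG : Function.Periodic (fun t => gradNormSq (u t)) (ℓ + d) := fun t => by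
    simp only [hper t]
  have hperE : Function.Periodic (fun t => ∫ x, ‖u t x‖ ^ 2) (ℓ + d) := fun t => by
    simp only [hper t]
  have hshiftG : ∫ t in (0 : ℝ)..(ℓ + d), gradNormSq (u t) =
      ∫ t in (-(d / 2))..(ℓ + d / 2), gradNormSq (u t) := by
    have h := hperG.intervalIntegral_add_eq (-(d / 2)) 0
    rw [zero_add, show -(d / 2) + (ℓ + d) = ℓ + d / 2 by ring] at h
    exact h.symm
  have hshiftE : ∫ t in (0 : ℝ)..(ℓ + d), (∫ x, ‖u t x‖ ^ 2) =
      ∫ t in (-(d / 2))..(ℓ + d / 2), (∫ x, ‖u t x‖ ^ 2) := by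
    have h := hperE.intervalIntegral_add_eq (-(d / 2)) 0
    rw [zero_add, show -(d / 2) + (ℓ + d) = ℓ + d / 2 by ring] at h
    exact h.symm
  have hsplitG : ∫ t in (-(d / 2))..(ℓ + d / 2), gradNormSq (u t) =
      (∫ t in (-(d / 2))..0, gradNormSq (u t)) + (∫ t in (0 : ℝ)..ℓ, gradNormSq (u t)) +
        ∫ t in ℓ..(ℓ + d / 2), gradNormSq (u t) := by
    rw [intervalIntegral.integral_add_adjacent_intervals (hGi _ _) (hGi _ _),
      intervalIntegral.integral_add_adjacent_intervals (hGi _ _) (hGi _ _)]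
  have hsplitE : ∫ t in (-(d / 2))..(ℓ + d / 2), (∫ x, ‖u t x‖ ^ 2) =
      (∫ t in (-(d / 2))..0, (∫ x, ‖u t x‖ ^ 2)) + (∫ t in (0 : ℝ)..ℓ, (∫ x, ‖u t x‖ ^ 2)) +
        ∫ t in ℓ..(ℓ + d / 2), (∫ x, ‖u t x‖ ^ 2) := by
    rw [intervalIntegral.integral_add_adjacent_intervals (hEi _ _) (hEi _ _),
      intervalIntegral.integral_add_adjacent_intervals (hEi _ _) (hEi _ _)]
  -- the window `[0, ℓ]` lies inside the period `[-d/2, ℓ + d/2]`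
  have hwinI : ∀ t ∈ Icc (0 : ℝ) ℓ, t ∈ Icc (-(d / 2)) (ℓ + d / 2) := fun t ht =>
    ⟨by linarith [ht.1], by linarith [ht.2]⟩
  refine ⟨?_, ?_⟩
  · /- DISSIPATION -/
    -- pointwise on the window: `‖∇u(t)‖₂² ≥ ‖∇u_Γ(t)‖₂² − 2δ√Ḡ`
    have hP3 : ∀ t ∈ Icc (0 : ℝ) ℓ, gradNormSq (uΓ t) - 2 * δ * Real.sqrt Gb ≤ gradNormSq (u t) := by
      intro t ht
      have hc := hclose t (hwinI t ht)
      have hgrad : gradNormSq (fun x => u t x - uΓ t x) ≤ δ ^ 2 := by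
        have h0 : 0 ≤ ∫ x, ‖u t x - uΓ t x‖ ^ 2 := integral_nonneg fun _ => sq_nonneg _
        unfold h1DistSq at hc
        linarith
      exact stub_trainBudget_aux_gradNormSq_window (hΓs.isSmooth_slice (mem_univ t))
        (hu.isSmooth_slice (mem_univ t)) hδ hgrad (hG t)
    -- integrate over the window
    have hci : IntervalIntegrable (fun t => gradNormSq (uΓ t) - 2 * δ * Real.sqrt Gb) volume 0 ℓ :=
      (hGΓc.sub continuous_const).intervalIntegrable 0 ℓ
    have hJwin : (∫ t in (0 : ℝ)..ℓ, gradNormSq (uΓ t)) - 2 * δ * Real.sqrt Gb * ℓ ≤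
        ∫ t in (0 : ℝ)..ℓ, gradNormSq (u t) := by
      have hmono := intervalIntegral.integral_mono_on hℓ.le hci (hGi 0 ℓ) hP3
      rw [intervalIntegral.integral_sub (hGΓc.intervalIntegrable 0 ℓ) intervalIntegrable_const,
        intervalIntegral.integral_const, sub_zero, smul_eq_mul] at hmono
      linarith
    -- the two dwell pieces are non-negative
    have hJ1 : 0 ≤ ∫ t in (-(d / 2))..0, gradNormSq (u t) :=
      intervalIntegral.integral_nonneg (by linarith) fun t _ => gradNormSq_nonneg _
    have hJ3 : 0 ≤ ∫ t in ℓ..(ℓ + d / 2), gradNormSq (u t) :=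
      intervalIntegral.integral_nonneg (by linarith) fun t _ => gradNormSq_nonneg _
    rw [meanDissipation_eq_period_mean hu hper hτ, hshiftG, hsplitG, div_eq_mul_inv,
      show (εx - 2 * ν * δ * Real.sqrt Gb) * (ℓ * (ℓ + d)⁻¹) =
        (ℓ + d)⁻¹ * ((εx - 2 * ν * δ * Real.sqrt Gb) * ℓ) by ring]
    refine mul_le_mul_of_nonneg_left ?_ (inv_nonneg.2 hτ.le)
    calc (εx - 2 * ν * δ * Real.sqrt Gb) * ℓ
        = εx * ℓ - ν * (2 * δ * Real.sqrt Gb * ℓ) := by ring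
      _ ≤ ν * (∫ t in (0 : ℝ)..ℓ, gradNormSq (uΓ t)) - ν * (2 * δ * Real.sqrt Gb * ℓ) := by
          linarith
      _ = ν * ((∫ t in (0 : ℝ)..ℓ, gradNormSq (uΓ t)) - 2 * δ * Real.sqrt Gb * ℓ) := by ring
      _ ≤ ν * ∫ t in (0 : ℝ)..ℓ, gradNormSq (u t) := mul_le_mul_of_nonneg_left hJwin hν
      _ ≤ ν * ((∫ t in (-(d / 2))..0, gradNormSq (u t)) + (∫ t in (0 : ℝ)..ℓ, gradNormSq (u t)) +
            ∫ t in ℓ..(ℓ + d / 2), gradNormSq (u t)) :=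
          mul_le_mul_of_nonneg_left (by linarith) hν
  · /- ENERGY -/
    -- pointwise on the whole period: `‖u(t)‖₂² ≤ 2‖u_Γ(t)‖₂² + 2δ²`
    have hP2 : ∀ t ∈ Icc (-(d / 2)) (ℓ + d / 2),
        (∫ x, ‖u t x‖ ^ 2) ≤ 2 * (∫ x, ‖uΓ t x‖ ^ 2) + 2 * δ ^ 2 := by
      intro t ht
      have hc := hclose t ht
      have hL2 : ∫ x, ‖u t x - uΓ t x‖ ^ 2 ≤ δ ^ 2 := by
        have h0 := gradNormSq_nonneg (fun x => u t x - uΓ t x)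
        unfold h1DistSq at hc
        linarith
      exact stub_trainBudget_aux_energy_window (hΓs.isSmooth_slice (mem_univ t))
        (hu.isSmooth_slice (mem_univ t)) hL2
    have hPt : ∀ t ∈ Icc (-(d / 2)) (ℓ + d / 2), (∫ x, ‖u t x‖ ^ 2) ≤ 2 * Pb + 2 * δ ^ 2 :=
      fun t ht => (hP2 t ht).trans (by linarith [hP t])
    -- `0 ≤ Ē` (it bounds a non-negative window mean, `ℓ > 0`)
    have hEb : 0 ≤ Eb := by
      have h0 : 0 ≤ ∫ t in (0 : ℝ)..ℓ, (∫ x, ‖uΓ t x‖ ^ 2) :=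
        intervalIntegral.integral_nonneg hℓ.le fun t _ => integral_nonneg fun _ => sq_nonneg _
      nlinarith
    -- the window piece
    have hI2 : ∫ t in (0 : ℝ)..ℓ, (∫ x, ‖u t x‖ ^ 2) ≤ 2 * (Eb * ℓ) + 2 * δ ^ 2 * ℓ := by
      have hci1 : IntervalIntegrable (fun t => 2 * (∫ x, ‖uΓ t x‖ ^ 2)) volume 0 ℓ :=
        (continuous_const.mul hEΓc).intervalIntegrable 0 ℓ
      have hci : IntervalIntegrable (fun t => 2 * (∫ x, ‖uΓ t x‖ ^ 2) + 2 * δ ^ 2) volume 0 ℓ :=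
        ((continuous_const.mul hEΓc).add continuous_const).intervalIntegrable 0 ℓ
      have hmono := intervalIntegral.integral_mono_on hℓ.le (hEi 0 ℓ) hci
        (fun t ht => hP2 t (hwinI t ht))
      rw [intervalIntegral.integral_add hci1 intervalIntegrable_const,
        intervalIntegral.integral_const_mul, intervalIntegral.integral_const, sub_zero,
        smul_eq_mul] at hmono
      linarith
    -- the two dwell pieces
    have hI1 : ∫ t in (-(d / 2))..0, (∫ x, ‖u t x‖ ^ 2) ≤ (2 * Pb + 2 * δ ^ 2) * (d / 2) := by
      have hmono := intervalIntegral.integral_mono_on (by linarith : -(d / 2) ≤ 0) (hEi _ _)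
        intervalIntegrable_const (fun t ht => hPt t ⟨ht.1, by linarith [ht.2]⟩)
      rw [intervalIntegral.integral_const, smul_eq_mul] at hmono
      linarith
    have hI3 : ∫ t in ℓ..(ℓ + d / 2), (∫ x, ‖u t x‖ ^ 2) ≤ (2 * Pb + 2 * δ ^ 2) * (d / 2) := by
      have hmono := intervalIntegral.integral_mono_on (by linarith : ℓ ≤ ℓ + d / 2) (hEi _ _)
        intervalIntegrable_const (fun t ht => hPt t ⟨by linarith [ht.1], ht.2⟩)
      rw [intervalIntegral.integral_const, smul_eq_mul] at hmono
      linarith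
    rw [meanEnergy_eq_period_mean hper hτ, hshiftE, hsplitE, inv_mul_le_iff₀ hτ,
      show (ℓ + d) * (2 * Eb + 2 * δ ^ 2 + 2 * Pb * (d / (ℓ + d))) =
        2 * Eb * (ℓ + d) + 2 * δ ^ 2 * (ℓ + d) + 2 * Pb * d by field_simp]
    nlinarith [mul_nonneg hEb hd]

end Summit.AnomalousDissipation.AnomalousDissipation.Theorems.DenseLoudDesignerForces.Homoclinic

end
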